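import Summits.BirchSwinnertonDyer.BirchSwinnertonDyer.Theorems.GenusKolyvaginAtTwoPowDvdShaCardAtTwoRTSelmerLayerOneCore
import Summits.BirchSwinnertonDyer.BirchSwinnertonDyer.Theorems.GenusKolyvaginAtTwoPowDvdShaCardAtTwoRTNonPhantomPowHabitat
import Summits.BirchSwinnertonDyer.BirchSwinnertonDyer.Theorems.GenusKolyvaginAtTwoPowDvdShaCardAtTwoRTTwinShaLaddersOfProp52Div
import Summits.BirchSwinnertonDyer.BirchSwinnertonDyer.Theorems.GenusKolyvaginAtTwoMinimalTwinBSDTwoBridges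
import HarnessLib

/-!
# Route `GenusKolyvaginAtTwo`, LINE 18 (L_T `PowDvdShaCardAtTwoRT`, stmt-BirchSwinnertonDyer-23659), stub P's reduction —
# KOLYVAGIN'S FIRST SELMER ANNIHILATION AT `2` («layer 1»), FRAME INSTANTIATED: on L_T's frame, modulo Q2 only,
# `2^(M₀+1) • (s + w • τ_* s) = 0` for every `s ∈ Sel_{2^M}(E/K)`, `M ≥ M₀ + 1`

Seat `bsd-line-gk2-p5` g28 (cell `bsd-f1-sign2`), `--supports stmt-BirchSwinnertonDyer-23659` (helper; closes nothing).  THEOREMS ONLY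
(no definition, no named fact, no `sorry`).  Sequel of `…RTSelmerLayerOneCore` (the core `selmerLayerOne_core` and its hybrid-frame
discharge `selmerLayerOne_core_hybrid`).  BSD is NOT proved by any of this; neither is L_T, U_T, nor stub P.

* §3 `selmerLayerOneAtTwo` — the frame BUILT inside (`poitouTate_selmerStructure_duality_conj_holds`, `exists_weilDatum_liftAut_two_pow`,
  `exists_hybridTransverseFamily`, as in the LEAD's `exactSwapAtTwo`), `z ∈ selmerGroup (W⁄K) (2^M)` in the tree's Selmer currency
  (`selmerGroup = H¹_{𝓕(1)}` by `placesDividing_one`, `selmerF_empty`, `selmerGroup_eq_selmerGroup_kummerSelmerStructure`):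
  `addOrderOf c_M(1) = 2^g`, `τ_* z = w • z` ⟹ **`2^(M+1−g) • z = 0`**, modulo Q2 + (NPh_{M+k}).
* §4 the `M₀`-currency of L_T: `selmerLayerOneAtTwo_of_divisibility` (`2^(M₀) ∥ y_K` ⟹ `g = M − M₀` by
  `addOrderOf_kolyvaginClass_two_eq_pow_sub_single`, so **`2^(M₀+1) • z = 0`** for every `(+w)`-eigen Selmer class at every level
  `M ≥ M₀ + 1`), `selmerLayerOneAtTwo_norm` (**`2^(M₀+1) • (s + w • τ_* s) = 0` for EVERY `s ∈ Sel_{2^M}(E/K)`**: `τ_*` is an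
  involution preserving `Sel`, `conjAct_mem_selmerGroup`, `conjAct_conjAct_of_mul_self`) and **`selmerLayerOneAtTwo_norm_onHabitat`**
  ((NPh) discharged by the frame's odd multiplicative prime, gk2-p3 `NonPhantomPow.nonPhantomAtTwo_of_hasMultiplicativeReductionAt`
  p714902; binders in L_T's own currency) — the LAYER-1 exponent bound of Kolyvagin's rank argument at `2`, input of gk2-p4 g21's
  «rank `E(K) ≤ 1` from the two exponent bounds via `E(K)/2^M ↪ Sel`», modulo Q2 (an antecedent of L_T) ONLY.

References: [GrossLMS1991] §5 (5.1), §8 Prop. 8.2, §10; [McCallumLMS1991] §5 Lemma 5.3, Thm. 5.4; [Kolyvagin1991MathAnn] §2 Thm. 2.2;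
[KolyvaginEulerSystems1990] Thm. A.
-/

set_option autoImplicit false
set_option linter.dupNamespace false

noncomputable section

open scoped Classical Pointwise
open Function NumberField IsDedekindDomain WeierstrassCurve Field
open Literature.NumberTheory.EllipticCurves Literature.NumberTheory.GaloisRepresentations
open Literature.NumberTheory.EllipticCurves.Jetchev2008 Literature.NumberTheory.EllipticCurves.ModularForms
open Literature.NumberTheory.GaloisCohomology
open Literature.NumberTheory.GaloisRepresentations.DiscreteGaloisModule (localTatePairingZMod
  tateDual transverseSubgroup SelmerStructure)
open Literature.NumberTheory.Automorphic
open Summit.BirchSwinnertonDyer.Rank1Residual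
open Summit.BirchSwinnertonDyer.Rank1Residual.JET.SelmerVocabulary
open Summit.BirchSwinnertonDyer.Rank1Residual.JET.GlobalDuality
open Summit.BirchSwinnertonDyer.BirchSwinnertonDyer.Theses.GenusKolyvaginAtTwo (KolyvaginRelationAtTwo)
open Summit.BirchSwinnertonDyer.BirchSwinnertonDyer.Theorems.KolyvaginLowerBoundAtTwo

namespace Summit.BirchSwinnertonDyer.BirchSwinnertonDyer.Theorems.GenusExact.PlusDescent

/-! ## §3 The frame instantiated: layer 1 in the tree's Selmer currency, modulo Q2 + (NPh_{M+k}) -/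

section Instantiated

variable {K : Type} [Field K] [NumberField K] (W : WeierstrassCurve ℚ) [W.IsElliptic] [W.IsGloballyMinimal] [NeZero (W.conductorNorm ℤ)]

/-- **KOLYVAGIN'S FIRST SELMER ANNIHILATION AT `2`, frame instantiated** (UNCONDITIONAL up to Q2 and (NPh_{M+k})): on L_T's habitat
(`E/ℚ` non-CM, `Δ < 0`, odd Tamagawa product, `ρ_{E,2^∞}` onto; `K` imaginary quadratic with `d_K` odd `≠ −3`, Heegner for `N_E`,
`d_K·(−|Δ|)` not a square; `τ ≠ 1`), for a conductor-`1` datum `d₁` with `addOrderOf c_M(1) = 2^g` (`g ≥ 1`) and every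
`z ∈ Sel_{2^M}(E/K)` with `τ_* z = w • z` (`w = W.rootNumber`): **`2^(M+1−g) • z = 0`**.
[cite: GrossLMS1991, §8 Prop. 8.2, §10] [cite: McCallumLMS1991, §5 Lemma 5.3, Thm. 5.4] [cite: Kolyvagin1991MathAnn, §2 Thm. 2.2] -/
theorem selmerLayerOneAtTwo (hCM : ¬ W.HasCM) (hΔ : W.Δ < 0) (hTam : Odd W.tamagawaProduct)
    (hsur : ∀ m : ℕ, W.HasSurjectiveModNGaloisRep (2 ^ m : ℕ)) (hK : IsImaginaryQuadratic K)
    (hodd : Odd (NumberField.discr K)) (hne3 : NumberField.discr K ≠ -3)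
    (hns : ¬ IsSquare ((NumberField.discr K : ℚ) * -|W.Δ|))
    (hHN : SatisfiesHeegnerHypothesis (W.conductorNorm ℤ) K) (τ : K ≃ₐ[ℚ] K) (hτ1 : τ ≠ 1)
    (Dt : ModularParametrizationData W (W.conductorNorm ℤ)) (β : ℤ) (ι : K →+* ℂ)
    (hQ2 : KolyvaginRelationAtTwo)
    {M k g : ℕ} (d₁ : KolyvaginHeegnerData Dt β ι 1)
    (hM : 1 ≤ M) (hk : 1 ≤ k) (hg : 1 ≤ g) (hord : addOrderOf (d₁.kolyvaginClass Nat.prime_two M) = 2 ^ g)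
    (hNPh : ∀ z : galH1Torsion (W.baseChange K) ((2 ^ (M + k) : ℕ) : ℤ),
      (∀ ρ ∈ torsionFixing (W.baseChange K) ((2 ^ (M + k) : ℕ) : ℤ),
        h1Eval (W.baseChange K) ((2 ^ (M + k) : ℕ) : ℤ) z ρ = 0) →
      (∀ w : HeightOneSpectrum (𝓞 K), ((2 * W.conductorNorm ℤ : ℕ) : 𝓞 K) ∈ w.asIdeal →
        z ∈ selmerLocalKer (W.baseChange K) (w.adicCompletion K) ((2 ^ (M + k) : ℕ) : ℤ)) → z = 0)
    (z : galH1Torsion (W.baseChange K) ((2 ^ M : ℕ) : ℤ))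
    (hz : z ∈ selmerGroup (W.baseChange K) ((2 ^ M : ℕ) : ℤ))
    (hzτ : conjAct W τ ((2 ^ M : ℕ) : ℤ) z = W.rootNumber • z) :
    ((2 ^ (M + 1 - g) : ℕ) : ℤ) • z = 0 := by
  classical
  haveI : Fact (Nat.Prime 2) := ⟨Nat.prime_two⟩
  haveI : ∀ j : ℕ, NumberField (ringClassField K ι j) := JET.numberField_ringClassField K hK ι
  haveI : (W.baseChange K).IsElliptic := by rw [baseChange]; infer_instance
  haveI hNZ : ∀ M : ℕ, NeZero (2 ^ M) := fun M ↦ ⟨pow_ne_zero M two_ne_zero⟩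
  haveI : ∀ M : ℕ, Finite (geomTorsion (W.baseChange K) ((2 ^ M : ℕ) : ℤ)) := fun M ↦
    finite_geomTorsion_of_neZero (W.baseChange K) (2 ^ M)
  -- the frame, per level: Poitou–Tate families, Weil data, hybrid structures
  have hinv : ∀ M : ℕ, ∃ inv : LocalInvariants K (2 ^ M), inv.IsPerfect ∧ inv.SumLocalTermEqZero ∧
      inv.UnramifiedOrthogonal ∧ inv.SelmerComplement ∧ ∀ σ : K ≃ₐ[ℚ] K, inv.IsConjCompatible σ :=
    fun M ↦ InputsPoitouTateSelmer.poitouTate_selmerStructure_duality_conj_holds K (2 ^ M)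
  choose inv hperf hvan hUO hSC hconj using hinv
  have hweil := fun M : ℕ ↦ exists_weilDatum_liftAut_two_pow (K := K) W τ M
  choose e hμ hadd₁ hadd₂ hgal halt hnondeg hτe using hweil
  have hhyb := fun M : ℕ ↦ exists_hybridTransverseFamily (K := K) W ι M
  choose 𝒯 hTko hTku using hhyb
  -- the Selmer class in the structure currency `H¹_{𝓕(1)} = H¹_𝓕`
  have hz' : z ∈ (selmerF W ((2 ^ M : ℕ) : ℤ) (𝒯 M) (placesDividing K 1)).selmerGroup := by
    rw [placesDividing_one, selmerF_empty, ← selmerGroup_eq_selmerGroup_kummerSelmerStructure]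
    exact hz
  exact selmerLayerOne_core_hybrid (W := W) (τ := τ) (Dt := Dt) (β := β) (ι := ι) (e := e) (hμ := hμ) (hadd₁ := hadd₁)
    (hadd₂ := hadd₂) (hgal := hgal) (halt := halt) (hnondeg := hnondeg) (hτe := hτe) (inv := inv) (𝒯 := 𝒯) (hCM := hCM)
    (hΔ := hΔ) (hTam := hTam) (hsur := hsur) (hK := hK) (hodd := hodd) (hne3 := hne3) (hns := hns) (hHN := hHN) (hτ1 := hτ1)
    (hperf := hperf) (hvan := hvan) (hinvc := fun M ↦ hconj M τ) (hTko := hTko) (hTku := hTku)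
    (hQ2 := hQ2) d₁ hM hk hg hord hNPh z hz' hzτ

/-! ## §4 The `M₀`-currency of L_T: `2^(M₀) ∥ y_K`, the norm form, and (NPh) discharged on the (D-NPh) habitat -/

/-- **Layer 1 in L_T's `M₀`-currency**: if `2^(M₀) ∣ y_K = P(1)` and `2^(M₀+1) ∤ y_K` in `E(K[1])` then `c_M(1)` has order `2^(M−M₀)`
(`addOrderOf_kolyvaginClass_two_eq_pow_sub_single`), so for every level `M ≥ M₀ + 1` and every `(+w)`-eigen Selmer class `z`:
**`2^(M₀+1) • z = 0`** (modulo Q2 + (NPh_{M+k})).  [cite: GrossLMS1991, §10] [cite: McCallumLMS1991, §5 Thm. 5.4] -/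
theorem selmerLayerOneAtTwo_of_divisibility (hCM : ¬ W.HasCM) (hΔ : W.Δ < 0) (hTam : Odd W.tamagawaProduct)
    (hsur : ∀ m : ℕ, W.HasSurjectiveModNGaloisRep (2 ^ m : ℕ)) (hK : IsImaginaryQuadratic K)
    (hodd : Odd (NumberField.discr K)) (hne3 : NumberField.discr K ≠ -3)
    (hns : ¬ IsSquare ((NumberField.discr K : ℚ) * -|W.Δ|))
    (hHN : SatisfiesHeegnerHypothesis (W.conductorNorm ℤ) K) (τ : K ≃ₐ[ℚ] K) (hτ1 : τ ≠ 1)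
    (Dt : ModularParametrizationData W (W.conductorNorm ℤ)) (β : ℤ) (ι : K →+* ℂ)
    (hQ2 : KolyvaginRelationAtTwo)
    (d₁ : KolyvaginHeegnerData Dt β ι 1) {M₀ M k : ℕ}
    (hdiv : ∃ Q : (W.baseChange (ringClassField K ι 1)).toAffine.Point, ((2 ^ M₀ : ℕ) : ℤ) • Q = d₁.derivedPoint)
    (hndiv : ¬ ∃ Q : (W.baseChange (ringClassField K ι 1)).toAffine.Point, ((2 ^ (M₀ + 1) : ℕ) : ℤ) • Q = d₁.derivedPoint)
    (hM : M₀ + 1 ≤ M) (hk : 1 ≤ k)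
    (hNPh : ∀ z : galH1Torsion (W.baseChange K) ((2 ^ (M + k) : ℕ) : ℤ),
      (∀ ρ ∈ torsionFixing (W.baseChange K) ((2 ^ (M + k) : ℕ) : ℤ),
        h1Eval (W.baseChange K) ((2 ^ (M + k) : ℕ) : ℤ) z ρ = 0) →
      (∀ w : HeightOneSpectrum (𝓞 K), ((2 * W.conductorNorm ℤ : ℕ) : 𝓞 K) ∈ w.asIdeal →
        z ∈ selmerLocalKer (W.baseChange K) (w.adicCompletion K) ((2 ^ (M + k) : ℕ) : ℤ)) → z = 0)
    (z : galH1Torsion (W.baseChange K) ((2 ^ M : ℕ) : ℤ))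
    (hz : z ∈ selmerGroup (W.baseChange K) ((2 ^ M : ℕ) : ℤ))
    (hzτ : conjAct W τ ((2 ^ M : ℕ) : ℤ) z = W.rootNumber • z) :
    ((2 ^ (M₀ + 1) : ℕ) : ℤ) • z = 0 := by
  have hsur1 : W.HasSurjectiveModNGaloisRep ((2 : ℤ) ^ 1) := by exact_mod_cast hsur 1
  have hord : addOrderOf (d₁.kolyvaginClass Nat.prime_two M) = 2 ^ (M - M₀) :=
    addOrderOf_kolyvaginClass_two_eq_pow_sub_single (Dt := Dt) (β := β) (ι := ι) hK hodd hne3 hHN hsur1 squarefree_one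
      (fun q hq ↦ by simp at hq) d₁ (by omega) hdiv hndiv
  have h := selmerLayerOneAtTwo W hCM hΔ hTam hsur hK hodd hne3 hns hHN τ hτ1 Dt β ι hQ2 d₁ (g := M - M₀) (by omega) hk
    (by omega) hord hNPh z hz hzτ
  rwa [show M + 1 - (M - M₀) = M₀ + 1 by omega] at h

/-- **Layer 1, NORM FORM** — for EVERY Selmer class (no eigen hypothesis): on L_T's habitat, `2^(M₀) ∥ y_K`, `M ≥ M₀ + 1`, modulo Q2 +
(NPh_{M+k}), for all `s ∈ Sel_{2^M}(E/K)`: **`2^(M₀+1) • (s + w • τ_* s) = 0`** (`w = W.rootNumber`; `s + w • τ_* s` is a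
`(+w)`-eigen Selmer class since `τ_*` is an involution preserving `Sel`).  For a `(−w)`-eigen class the statement is empty; for a
`(+w)`-eigen class it is `2^(M₀+2) • s = 0` (use `selmerLayerOneAtTwo_of_divisibility` for the sharper `2^(M₀+1)`).
[cite: GrossLMS1991, §5 (5.1), §10] [cite: McCallumLMS1991, §5 Thm. 5.4] -/
theorem selmerLayerOneAtTwo_norm (hCM : ¬ W.HasCM) (hΔ : W.Δ < 0) (hTam : Odd W.tamagawaProduct)
    (hsur : ∀ m : ℕ, W.HasSurjectiveModNGaloisRep (2 ^ m : ℕ)) (hK : IsImaginaryQuadratic K)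
    (hodd : Odd (NumberField.discr K)) (hne3 : NumberField.discr K ≠ -3)
    (hns : ¬ IsSquare ((NumberField.discr K : ℚ) * -|W.Δ|))
    (hHN : SatisfiesHeegnerHypothesis (W.conductorNorm ℤ) K) (τ : K ≃ₐ[ℚ] K) (hτ1 : τ ≠ 1)
    (Dt : ModularParametrizationData W (W.conductorNorm ℤ)) (β : ℤ) (ι : K →+* ℂ)
    (hQ2 : KolyvaginRelationAtTwo)
    (d₁ : KolyvaginHeegnerData Dt β ι 1) {M₀ M k : ℕ}
    (hdiv : ∃ Q : (W.baseChange (ringClassField K ι 1)).toAffine.Point, ((2 ^ M₀ : ℕ) : ℤ) • Q = d₁.derivedPoint)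
    (hndiv : ¬ ∃ Q : (W.baseChange (ringClassField K ι 1)).toAffine.Point, ((2 ^ (M₀ + 1) : ℕ) : ℤ) • Q = d₁.derivedPoint)
    (hM : M₀ + 1 ≤ M) (hk : 1 ≤ k)
    (hNPh : ∀ z : galH1Torsion (W.baseChange K) ((2 ^ (M + k) : ℕ) : ℤ),
      (∀ ρ ∈ torsionFixing (W.baseChange K) ((2 ^ (M + k) : ℕ) : ℤ),
        h1Eval (W.baseChange K) ((2 ^ (M + k) : ℕ) : ℤ) z ρ = 0) →
      (∀ w : HeightOneSpectrum (𝓞 K), ((2 * W.conductorNorm ℤ : ℕ) : 𝓞 K) ∈ w.asIdeal →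
        z ∈ selmerLocalKer (W.baseChange K) (w.adicCompletion K) ((2 ^ (M + k) : ℕ) : ℤ)) → z = 0)
    (s : galH1Torsion (W.baseChange K) ((2 ^ M : ℕ) : ℤ))
    (hs : s ∈ selmerGroup (W.baseChange K) ((2 ^ M : ℕ) : ℤ)) :
    ((2 ^ (M₀ + 1) : ℕ) : ℤ) • (s + W.rootNumber • conjAct W τ ((2 ^ M : ℕ) : ℤ) s) = 0 := by
  have hττ : τ * τ = 1 := mul_self_eq_one_of_isImaginaryQuadratic hK τ
  set z := s + W.rootNumber • conjAct W τ ((2 ^ M : ℕ) : ℤ) s with hz_def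
  have hz : z ∈ selmerGroup (W.baseChange K) ((2 ^ M : ℕ) : ℤ) :=
    add_mem hs (AddSubgroup.zsmul_mem _ (conjAct_mem_selmerGroup W (fun w ↦ hK.2.isComplex w) τ _ hs) _)
  have hzτ : conjAct W τ ((2 ^ M : ℕ) : ℤ) z = W.rootNumber • z := by
    rw [hz_def, map_add, map_zsmul, conjAct_conjAct_of_mul_self W hττ]
    rcases W.rootNumber_eq_one_or with h | h
    · simp only [h, one_zsmul]; abel
    · simp only [h, neg_one_zsmul]; abel
  exact selmerLayerOneAtTwo_of_divisibility W hCM hΔ hTam hsur hK hodd hne3 hns hHN τ hτ1 Dt β ι hQ2 d₁ hdiv hndiv hM hk hNPh z hz hzτ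

/-- **Layer 1 ON L_T's FRAME, modulo Q2 ONLY** ((NPh) DISCHARGED by the frame's odd multiplicative prime, gk2-p3
`NonPhantomPow.nonPhantomAtTwo_of_hasMultiplicativeReductionAt`, p714902; binders in L_T's own currency): for `E/ℚ` non-CM with odd
Tamagawa product, an odd prime `v ∣ N` of multiplicative reduction, `Δ < 0`, `ρ_{E,2^n}` onto for all `n ≥ 1`; `K` imaginary quadratic
with `d_K` odd `≠ −3`, Heegner for `N`, `d_K·(−|Δ|)` and `d_K·(−2|Δ|)` non-squares; a frame `(Dt, β, ι)`, a conductor-`1` datum `d₁`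
with `2^(M₀) ∥ P(1)`; `τ ≠ 1`: for every level `M ≥ M₀ + 1` and EVERY `s ∈ Sel_{2^M}(E/K)`, **`2^(M₀+1) • (s + w • τ_* s) = 0`**.
This is the layer-1 exponent bound of Kolyvagin's rank argument at `2` (the `(+w)`-eigenpart of `Sel_{2^M}(E/K)`, i.e. the side of
`E(ℚ)` when `w = +1`, is bounded independently of `M`).  [cite: GrossLMS1991, §10] [cite: KolyvaginEulerSystems1990, Thm. A]
[cite: McCallumLMS1991, §5 Thm. 5.4] -/
theorem selmerLayerOneAtTwo_norm_onHabitat (hQ2 : KolyvaginRelationAtTwo)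
    (hCM : ¬ W.HasCM) (hTam : Odd W.tamagawaProduct)
    (v : HeightOneSpectrum (𝓞 ℚ)) (h2v : ((2 : ℕ) : 𝓞 ℚ) ∉ v.asIdeal)
    (hNv : ((W.conductorNorm ℤ : ℕ) : 𝓞 ℚ) ∈ v.asIdeal) (hmult : W.HasMultiplicativeReductionAt v) (hΔ : W.Δ < 0)
    (hK : IsImaginaryQuadratic K) (hodd : Odd (NumberField.discr K)) (hne3 : NumberField.discr K ≠ -3)
    (hHN : SatisfiesHeegnerHypothesis (W.conductorNorm ℤ) K)
    (hns : ¬ IsSquare ((NumberField.discr K : ℚ) * -|W.Δ|)) (hns₂ : ¬ IsSquare ((NumberField.discr K : ℚ) * (-(2 * |W.Δ|))))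
    (hρ : ∀ n : ℕ, 0 < n → W.HasSurjectiveModNGaloisRep ((2 : ℤ) ^ n))
    (Dt : ModularParametrizationData W (W.conductorNorm ℤ)) (β : ℤ) (ι : K →+* ℂ)
    (d₁ : KolyvaginHeegnerData Dt β ι 1) (M₀ : ℕ)
    (hdiv : ∃ Q : (W.baseChange (ringClassField K ι 1)).toAffine.Point, ((2 ^ M₀ : ℕ) : ℤ) • Q = d₁.derivedPoint)
    (hndiv : ¬ ∃ Q : (W.baseChange (ringClassField K ι 1)).toAffine.Point, ((2 ^ (M₀ + 1) : ℕ) : ℤ) • Q = d₁.derivedPoint)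
    (τ : K ≃ₐ[ℚ] K) (hτ1 : τ ≠ 1) {M : ℕ} (hM : M₀ + 1 ≤ M)
    (s : galH1Torsion (W.baseChange K) ((2 ^ M : ℕ) : ℤ))
    (hs : s ∈ selmerGroup (W.baseChange K) ((2 ^ M : ℕ) : ℤ)) :
    ((2 ^ (M₀ + 1) : ℕ) : ℤ) • (s + W.rootNumber • conjAct W τ ((2 ^ M : ℕ) : ℤ) s) = 0 := by
  -- currency of the big-image binder
  have hsurN : ∀ m : ℕ, W.HasSurjectiveModNGaloisRep ((2 ^ m : ℕ) : ℤ) :=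
    MinimalTwinBSDTwo.forall_hasSurjectiveModNGaloisRep_two_pow_of_pos W hρ
  have hsur : ∀ m : ℕ, W.HasSurjectiveModNGaloisRep (2 ^ m : ℕ) := fun m ↦ by exact_mod_cast hsurN m
  -- (NPh) at level `2^(M+1)` from the odd multiplicative prime
  have hNPh := NonPhantomPow.nonPhantomAtTwo_of_hasMultiplicativeReductionAt W hTam hρ hK hodd hns hns₂
    (NeZero.ne (W.conductorNorm ℤ)) hHN h2v hNv hmult (M + 1) (by omega)
  exact selmerLayerOneAtTwo_norm W hCM hΔ hTam hsur hK hodd hne3 hns hHN τ hτ1 Dt β ι hQ2 d₁ hdiv hndiv hM le_rfl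
    hNPh s hs

end Instantiated

end Summit.BirchSwinnertonDyer.BirchSwinnertonDyer.Theorems.GenusExact.PlusDescent

end
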